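import Literature.Barriers.RiemannHypothesis.TuranPartialSumsSmoothedZero
import Literature.Barriers.RiemannHypothesis.TuranPartialSumsSmoothedPerron
import Literature.Barriers.RiemannHypothesis.TuranPartialSumsBohr
import HarnessLib

/-!
# Montgomery 1983 for the Cesàro means `C_N`: twisted zeros beyond `1 + c log log N/log N`

Proofs-only companion of `Literature/Barriers/RiemannHypothesis/TuranPartialSums.lean` (named fact
`Literature.Barriers.RiemannHypothesis.montgomery1983_smoothedRemark`, Montgomery 1983, §1 p. 498: "our proof
of the Theorem, mutatis mutandis, applies to these functions [`C_N`, `V_N`, `A_N`] as well"). Two auxiliary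
definitions (the twisted Cesàro section and its frozen kernel factor, concrete functions), no named facts.

For Montgomery's twist `a = montgomeryTwist m` and `P_N(s) = Σ_{n ≤ N} (1 − n/N) a(n) n^{−s}`:

* `norm_cesaroTwisted_sub_model_le` — the two-term model of §4 (24)–(25) on the box:
  `P_N(s) = f(s) + a₀ q_C(s) e^{−Λ(s−1)} + O(ε |a₀| e^{−Λ(σ−1)})`, from the exact smoothed Perron formula
  (`cesaro_twisted_eq`, kernel `1/(w(w+1))`), the piece decomposition of the line `Re(s+w) = 1 + 1/log N`
  (`kernel_integral_eq_sum_gpieces`, factor `η̃(u) = 1/(α+1+iu)`), the line estimate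
  (`norm_lineIntegral_sub_model_le`) and the tails of the absolutely convergent kernel;
* `cesaroQ_modelBox`, `norm_cesaroQ_sub_le` — `1/6 ≤ |q_C| ≤ 4` and `q_C` is `36`-Lipschitz on the box;
* `exists_cesaroTwisted_zeros` — the closing argument (`exists_zero_of_good`, `eventually_good` with `ρ ≡ 1`,
  `H = 4`): for some `c > 0` and all large `N`, a completely multiplicative unimodular twist of `C_N` vanishes
  at a point with `Re s > 1 + c log log N/log N` (hypothesis `hC` of
  `montgomery1983_smoothedRemark_of_twisted_zeros`).

## References

* [Montgomery1983] H. L. Montgomery, *Zeros of approximations to the zeta function*, Studies in Pure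
  Mathematics (Turán memorial), Birkhäuser 1983, 497–506: §1 p. 498 (`C_N`), §2 (5), §4 (20)–(25), p. 506.
-/

noncomputable section

open Complex Set Filter Topology MeasureTheory intervalIntegral Asymptotics
open scoped Interval

namespace Literature.Barriers.RiemannHypothesis

section Cesaro

variable (m : ℕ)

/-- The Cesàro-weighted section twisted by Montgomery's `a(n)`: `P_N(s) = Σ_{n ≤ N} (1 − n/N) a(n) n^{−s}`.
[cite: Montgomery1983, §1 p. 498 and §2 (3)] -/
def cesaroTwisted (N : ℕ) (s : ℂ) : ℂ :=
  ∑ n ∈ Finset.Icc 1 N, (1 - (n : ℂ) / N) * montgomeryTwist m n * (n : ℂ) ^ (-s)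

/-- The frozen kernel factor of the Cesàro model: `q_C(s) = 1/((2 + 1/Λ + i − s)(1 + 1/Λ + i − s))` (the
kernel `1/(w(w+1))` at the singularity `w = 1 + 1/Λ + i − s` of the first mode). [cite: Montgomery1983, §4 (24)] -/
def cesaroQ (Λ : ℝ) (s : ℂ) : ℂ := 1 / ((zline Λ 1 - s + 1) * (zline Λ 1 - s))

/-- `P_N` is entire. [folklore] -/
theorem differentiable_cesaroTwisted (N : ℕ) : Differentiable ℂ (cesaroTwisted m N) := by
  unfold cesaroTwisted
  refine Differentiable.fun_sum fun n hn ↦ ?_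
  have hn0 : (n : ℂ) ≠ 0 := by
    rw [Finset.mem_Icc] at hn; exact_mod_cast (show n ≠ 0 by omega)
  exact (differentiable_const _).mul (differentiable_neg.const_cpow (Or.inl hn0))

section ModelC

variable {A₁ A₂ A₃ A₄ : ℝ}
  (h18 : ∀ (k : ℤ) (z : ℂ), 1 < z.re → z.re ≤ 2 → |z.im - k| ≤ 1 / 2 →
    ‖montgomeryPhi m z + (montgomeryCoeff m k : ℂ) * log (z - 1 - k * I)‖ ≤
      A₁ + A₂ * Real.log (Real.log (|(k : ℝ)| + 5)))
  (h19 : ∀ (k : ℤ) (z : ℂ), 1 < z.re → z.re ≤ 2 → |z.im - k| ≤ 1 / 2 →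
    ‖montgomeryPhiDeriv m z + (montgomeryCoeff m k : ℂ) / (z - 1 - k * I)‖ ≤ A₃ + A₄ * Real.log (|(k : ℝ)| + 5))
include h18 h19

/-- **The two-term model for the twisted Cesàro means.** Let `Λ = log N ≥ max(20, L₁²)`,
`1 + 11/Λ ≤ Re s ≤ 3/2`, `|Im s| ≤ 5/Λ`, `K₀ ≥ 1`. Then
`‖P_N(s) − f(s) − a₀ q_C(s) e^{−Λ(s−1)}‖ ≤ (e/2π)(lineErr(4, Λ, |α|/2, Λ^{-1/2}, K₀) + 2(Λ+1)/K₀) e^{−Λ(Re s−1)}`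
with `a₀ = e^{iΛ} Λ^{β−1} g₁(0)/Γ(β)`, `α = 1 + 1/Λ − Re s` ((24)–(25) for `C_N`: (5) with the kernel
`1/(w(w+1))`, the line cut into pieces, the tails `|w| > K₀` bounded by `(Λ+1)N^α/K₀`).
[cite: Montgomery1983, §4 (24)–(25)] -/
theorem norm_cesaroTwisted_sub_model_le (hA₂ : 0 ≤ A₂) (hA₃ : 0 ≤ A₃) (hA₄ : 0 ≤ A₄) {N : ℕ}
    (hΛ20 : 20 ≤ Real.log N) (hΛL : (A₃ + A₄ * Real.log 6) ^ 2 ≤ Real.log N) {s : ℂ}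
    (hσ1 : 1 + 11 / Real.log N ≤ s.re) (hσ2 : s.re ≤ 3 / 2) (ht : |s.im| ≤ 5 / Real.log N)
    {K₀ : ℕ} (hK₀ : 1 ≤ K₀) :
    ‖cesaroTwisted m N s - montgomeryF m s -
        (exp ((Real.log N : ℂ) * I) *
            ((Real.log N ^ (montgomeryCoeff m 1 - 1) / Real.Gamma (montgomeryCoeff m 1) : ℝ) : ℂ) *
            gOne m (Real.log N) 0) * cesaroQ (Real.log N) s * exp (-(Real.log N : ℂ) * (s - 1))‖ ≤
      Real.exp 1 / (2 * Real.pi) *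
        (lineErr m A₁ A₂ A₃ A₄ 4 (Real.log N) (|1 + 1 / Real.log N - s.re| / 2)
            ((Real.log N) ^ (-(1 / 2 : ℝ))) K₀ + 2 * (Real.log N + 1) / K₀) *
        Real.exp (-Real.log N * (s.re - 1)) := by
  set Λ := Real.log N with hΛdef
  have hΛ0 : 0 < Λ := by linarith
  have hN1 : 1 < (N : ℝ) := by
    by_contra h
    have := Real.log_nonpos (Nat.cast_nonneg N) (not_lt.1 h)
    linarith
  have hNpos : 0 < N := by exact_mod_cast (zero_lt_one.trans hN1)
  set x : ℝ := (N : ℝ) with hxdef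
  have hx0 : 0 < x := by linarith
  have hxc : ((N : ℝ) : ℂ) = (N : ℂ) := by push_cast; rfl
  set σ := s.re with hσ
  set t := s.im with htdef
  set α : ℝ := 1 + 1 / Λ - σ with hα
  have h11 : 11 / Λ ≤ σ - 1 := by linarith
  have hα0 : α < 0 := by
    rw [hα]; have : 1 / Λ < 11 / Λ := div_lt_div_of_pos_right (by norm_num) hΛ0; linarith
  have hα1 : -1 < α := by rw [hα]; have := one_div_pos.2 hΛ0; linarith
  have hα1' : 0 < α + 1 := by linarith
  have hσα : 1 < s.re + α := by rw [← hσ, hα]; have := one_div_pos.2 hΛ0; linarith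
  have hre : ∀ u : ℝ, (s + α + u * I).re = 1 + 1 / Λ := by
    intro u; simp [← hσ, hα]
  have ht4 : |t| ≤ 1 / 4 := ht.trans (by rw [div_le_iff₀ hΛ0]; linarith)
  -- (1) the exact smoothed Perron formula
  have hPerron := cesaro_twisted_eq (a := fun n ↦ montgomeryTwist m n) (norm_montgomeryTwist_le_one m)
    hα1 hα0 hσα hNpos
  -- the kernel and the integrand
  set κ : ℝ → ℂ := fun y ↦ 1 / (((α : ℂ) + y * I) * ((α : ℂ) + y * I + 1)) with hκ
  set Ff : ℝ → ℂ := fun y ↦ montgomeryF m (s + α + y * I) * (x : ℂ) ^ ((α : ℂ) + y * I) with hFf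
  set G : ℝ → ℂ := fun y ↦ Ff y * κ y with hG
  have hden1 : ∀ y : ℝ, (α : ℂ) + y * I ≠ 0 := fun y h ↦ by
    have := congrArg Complex.re h; simp at this; exact hα0.ne this
  have hden2 : ∀ y : ℝ, (α : ℂ) + y * I + 1 ≠ 0 := fun y h ↦ by
    have := congrArg Complex.re h; simp at this; linarith
  have hP : cesaroTwisted m N s = montgomeryF m s + (1 / (2 * Real.pi)) * ∫ y : ℝ, G y := by
    have h1 : (∫ y : ℝ, LSeries (fun n ↦ montgomeryTwist m n) (s + α + y * I) *
        (N : ℂ) ^ ((α : ℂ) + y * I) * (1 / (((α : ℂ) + y * I) * ((α : ℂ) + y * I + 1)))) = ∫ y : ℝ, G y := by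
      refine integral_congr_ae (Eventually.of_forall fun y ↦ ?_)
      simp only [hG, hFf, hκ, montgomeryF, hxdef, hxc]
    rw [cesaroTwisted, hPerron, h1]; rfl
  -- (2) sizes on the line
  have hxα_norm : ∀ y : ℝ, ‖(x : ℂ) ^ ((α : ℂ) + y * I)‖ = x ^ α := fun y ↦
    Literature.NumberTheory.LFunctions.norm_cpow_line hx0 α y
  have hFf_le : ∀ y : ℝ, ‖Ff y‖ ≤ (Λ + 1) * x ^ α := by
    intro y
    simp only [hFf, norm_mul, hxα_norm]
    exact mul_le_mul_of_nonneg_right (norm_montgomeryF_le_of_re m hΛ0 (hre y)) (Real.rpow_nonneg hx0.le _)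
  have hκ_le : ∀ y : ℝ, 1 ≤ |y| → ‖κ y‖ ≤ 1 / y ^ 2 := by
    intro y hy
    have hy0 : 0 < |y| := by linarith
    have hA : |y| ≤ ‖(α : ℂ) + y * I‖ := by
      calc |y| = |((α : ℂ) + y * I).im| := by simp
        _ ≤ _ := abs_im_le_norm _
    have hB : |y| ≤ ‖(α : ℂ) + y * I + 1‖ := by
      calc |y| = |((α : ℂ) + y * I + 1).im| := by simp
        _ ≤ _ := abs_im_le_norm _
    simp only [hκ, norm_div, norm_one, norm_mul]
    rw [show y ^ 2 = |y| * |y| by rw [← sq_abs]; ring]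
    exact one_div_le_one_div_of_le (mul_pos hy0 hy0) (mul_le_mul hA hB hy0.le (norm_nonneg _))
  -- continuity and integrability
  have hFf_cont : Continuous Ff := by
    have h1 : Continuous fun u : ℝ ↦ montgomeryF m (s + α + u * I) := by
      refine continuous_iff_continuousAt.2 fun u ↦ ?_
      have hd := differentiableAt_montgomeryF m (z := s + α + u * I) (by rw [hre]; linarith [one_div_pos.2 hΛ0])
        (by rw [hre]; have : 1 / Λ ≤ 1 / 2 := one_div_le_one_div_of_le (by norm_num) (by linarith); linarith)
      exact hd.continuousAt.comp (f := fun u : ℝ ↦ s + α + u * I) (by fun_prop)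
    have h2 : Continuous fun u : ℝ ↦ (x : ℂ) ^ ((α : ℂ) + u * I) := by
      simp_rw [ofReal_cpow_eq_exp hx0]; fun_prop
    simp only [hFf]; exact h1.mul h2
  have hκ_int : Integrable κ := integrable_cesaroKernel_line hα0.ne hα1'.ne'
  have hG_int : Integrable G := by
    simp only [hG]
    refine hκ_int.bdd_mul hFf_cont.aestronglyMeasurable (c := (Λ + 1) * x ^ α)
      (Eventually.of_forall hFf_le)
  -- (3) tails
  set T₁ : ℝ := (K₀ : ℝ) + 1 / 2 - t with hT₁
  set T₂ : ℝ := (K₀ : ℝ) + 1 / 2 + t with hT₂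
  have hK₀1 : (1 : ℝ) ≤ K₀ := by exact_mod_cast hK₀
  have hT₁K : (K₀ : ℝ) ≤ T₁ := by rw [hT₁]; linarith [(abs_le.1 ht4).2]
  have hT₂K : (K₀ : ℝ) ≤ T₂ := by rw [hT₂]; linarith [(abs_le.1 ht4).1]
  have htails : ‖(∫ y, G y) - ∫ y in (-T₂)..T₁, G y‖ ≤ 2 * ((Λ + 1) * x ^ α) / K₀ := by
    have h := norm_integral_sub_intervalIntegral_le hG_int (C := (Λ + 1) * x ^ α) (hK₀1.trans hT₁K)
      (hK₀1.trans hT₂K) (fun u hu ↦ ?_)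
    · refine h.trans ?_
      have hC0 : 0 ≤ (Λ + 1) * x ^ α := by positivity
      have hK₀pos : (0 : ℝ) < K₀ := by linarith
      calc (Λ + 1) * x ^ α / T₁ + (Λ + 1) * x ^ α / T₂ ≤ (Λ + 1) * x ^ α / K₀ + (Λ + 1) * x ^ α / K₀ :=
            add_le_add (div_le_div_of_nonneg_left hC0 hK₀pos hT₁K) (div_le_div_of_nonneg_left hC0 hK₀pos hT₂K)
        _ = _ := by ring
    · simp only [hG, norm_mul]
      have hu0 : 0 < u ^ 2 := by
        have : 0 < |u| := by linarith
        rw [← sq_abs]; exact pow_pos this 2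
      calc ‖Ff u‖ * ‖κ u‖ ≤ ((Λ + 1) * x ^ α) * (1 / u ^ 2) :=
            mul_le_mul (hFf_le u) (hκ_le u hu) (norm_nonneg _) (by positivity)
        _ = (Λ + 1) * x ^ α / u ^ 2 := by ring
  -- (4) the kernel factor `η̃(u) = 1/(α + iu + 1)`
  set ηt : ℝ → ℂ := fun u ↦ ((α : ℂ) + u * I + 1)⁻¹ with hηt
  set ηt' : ℝ → ℂ := fun u ↦ -I / ((α : ℂ) + u * I + 1) ^ 2 with hηt'
  have hηd : ∀ u : ℝ, HasDerivAt ηt (ηt' u) u := by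
    intro u
    have h1 : HasDerivAt (fun w : ℂ ↦ (α : ℂ) + w * I + 1) I (u : ℂ) := by
      simpa using ((hasDerivAt_id (u : ℂ)).mul_const I).const_add (α : ℂ) |>.add_const (1 : ℂ)
    have h2 := (h1.inv (hden2 u)).comp_ofReal
    simp only [hηt, hηt']
    refine h2.congr_of_eventuallyEq (Eventually.of_forall fun v ↦ ?_) |>.congr_deriv ?_
    · simp
    · ring
  have hηcont : Continuous ηt' := by
    simp only [hηt']
    exact continuous_const.div ((by fun_prop : Continuous fun u : ℝ ↦ (α : ℂ) + u * I + 1).pow 2)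
      (fun u ↦ pow_ne_zero 2 (hden2 u))
  have hηt_cont : Continuous ηt := by
    simp only [hηt]
    exact Continuous.inv₀ (by fun_prop) hden2
  have hD_ge : ∀ u : ℝ, 1 / 2 ≤ ‖(α : ℂ) + u * I + 1‖ := by
    intro u
    calc (1 : ℝ) / 2 ≤ α + 1 := by rw [hα]; have := one_div_pos.2 hΛ0; linarith
      _ = |((α : ℂ) + u * I + 1).re| := by rw [abs_of_pos (by simp; linarith)]; simp
      _ ≤ _ := abs_re_le_norm _
  have hηb : ∀ u : ℝ, ‖ηt u‖ ≤ 4 := by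
    intro u
    simp only [hηt, norm_inv]
    calc ‖(α : ℂ) + u * I + 1‖⁻¹ ≤ (1 / 2)⁻¹ := by
          rw [inv_le_inv₀ (lt_of_lt_of_le (by norm_num) (hD_ge u)) (by norm_num)]; exact hD_ge u
      _ ≤ 4 := by norm_num
  have hηb' : ∀ u : ℝ, ‖ηt' u‖ ≤ 4 := by
    intro u
    simp only [hηt', norm_div, norm_neg, norm_I, norm_pow]
    rw [one_div_le (by have := hD_ge u; positivity) (by norm_num)]
    calc (1 : ℝ) / 4 = (1 / 2) ^ 2 := by norm_num
      _ ≤ ‖(α : ℂ) + u * I + 1‖ ^ 2 := pow_le_pow_left₀ (by norm_num) (hD_ge u) 2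
  -- (5) the middle part as a sum of pieces
  have hmid_congr : ∫ y in (-T₂)..T₁, G y = ∫ u in (-T₂)..T₁,
      montgomeryF m (s + α + u * I) * (x : ℂ) ^ ((α : ℂ) + u * I) * (ηt u / ((α : ℂ) + u * I)) := by
    refine intervalIntegral.integral_congr fun u _ ↦ ?_
    simp only [hG, hFf, hκ, hηt]
    field_simp [hden1 u, hden2 u]
  have hx1 : 1 < x := hN1
  have hx2 : 2 ≤ Real.log x := by rw [hxdef]; linarith
  have hσ' : s.re + α = 1 + 1 / Real.log x := by rw [← hσ, hα, hxdef]; ring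
  have hpieces := kernel_integral_eq_sum_gpieces m hx1 hx2 hσ' hα0.ne hηt_cont K₀
  rw [← hT₁, ← hT₂] at hpieces
  -- (6) the line estimate
  have hmodel := norm_lineIntegral_sub_model_le m h18 h19 hA₂ hA₃ hA₄ hx1 (by rwa [hxdef]) (by rwa [hxdef])
    (s := s) (by rwa [hxdef]) hσ2 (by rwa [hxdef]) (H := 4) (by norm_num) hηd hηcont hηb hηb' hK₀
  -- (7) identification of `q`
  have hd : (α : ℂ) + ((1 - t : ℝ) : ℂ) * I = zline Λ 1 - s := by
    rw [hα, zline, ← re_add_im s, ← hσ, ← htdef]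
    push_cast; ring
  have hq : ηt (1 - t) / (zline Λ 1 - s) = cesaroQ Λ s := by
    have h1 : zline Λ 1 - s ≠ 0 := by
      rw [← hd]; intro h; have := congrArg Complex.re h; simp at this; exact hα0.ne this
    have h2 : zline Λ 1 - s + 1 ≠ 0 := by
      rw [← hd]; intro h; have := congrArg Complex.re h; simp at this; linarith
    have he : (α : ℂ) + ((1 - t : ℝ) : ℂ) * I + 1 = zline Λ 1 - s + 1 := by rw [← hd]
    simp only [hηt, cesaroQ]
    rw [he, div_eq_mul_inv, ← mul_inv, one_div]
  -- (8) assembling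
  have hxα : x ^ α = Real.exp 1 * Real.exp (-Λ * (σ - 1)) := by
    rw [Real.rpow_def_of_pos hx0, ← hΛdef, ← Real.exp_add]
    congr 1; rw [hα]; field_simp; ring
  rw [← htdef] at hmodel hpieces
  rw [← hα, hq] at hmodel
  set S := ∑ i ∈ Finset.range (2 * K₀ + 1), ∫ v in (-(1 / 2))..(1 / 2),
    gpiece m Λ α t (fun v ↦ (x : ℂ) ^ (((((i : ℤ) - K₀ : ℤ) : ℝ) - t : ℝ) * I) *
      ηt ((((i : ℤ) - K₀ : ℤ) : ℝ) + v - t)) ((i : ℤ) - K₀) v * exp (((Λ * v : ℝ) : ℂ) * I) with hS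
  set A : ℂ := exp ((Λ : ℂ) * I) *
    ((Λ ^ (montgomeryCoeff m 1 - 1) / Real.Gamma (montgomeryCoeff m 1) : ℝ) : ℂ) * gOne m Λ 0 with hA
  set E : ℂ := exp (-(Λ : ℂ) * (s - 1)) with hE
  have hmid : (1 / (2 * (Real.pi : ℂ))) * ∫ y in (-T₂)..T₁, G y = (((x ^ α / (2 * Real.pi)) : ℝ) : ℂ) * S := by
    rw [hmid_congr, hpieces, ← Complex.ofReal_cpow hx0.le]
    push_cast
    ring
  have hdecomp : cesaroTwisted m N s - montgomeryF m s - A * cesaroQ Λ s * E =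
      (1 / (2 * (Real.pi : ℂ))) * ((∫ y, G y) - ∫ y in (-T₂)..T₁, G y) +
        ((((x ^ α / (2 * Real.pi)) : ℝ) : ℂ) * S - A * cesaroQ Λ s * E) := by
    rw [hP, ← hmid]; ring
  rw [hdecomp]
  have hnorm_coef : ‖(1 / (2 * (Real.pi : ℂ)))‖ = 1 / (2 * Real.pi) := by
    rw [show (1 / (2 * (Real.pi : ℂ))) = (((1 / (2 * Real.pi)) : ℝ) : ℂ) by push_cast; ring, norm_real,
      Real.norm_eq_abs, abs_of_pos (by positivity)]
  calc ‖(1 / (2 * (Real.pi : ℂ))) * ((∫ y, G y) - ∫ y in (-T₂)..T₁, G y) +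
        ((((x ^ α / (2 * Real.pi)) : ℝ) : ℂ) * S - A * cesaroQ Λ s * E)‖
      ≤ ‖(1 / (2 * (Real.pi : ℂ))) * ((∫ y, G y) - ∫ y in (-T₂)..T₁, G y)‖ +
          ‖(((x ^ α / (2 * Real.pi)) : ℝ) : ℂ) * S - A * cesaroQ Λ s * E‖ := norm_add_le _ _
    _ ≤ 1 / (2 * Real.pi) * (2 * ((Λ + 1) * x ^ α) / K₀) +
          Real.exp 1 / (2 * Real.pi) * lineErr m A₁ A₂ A₃ A₄ 4 Λ (|α| / 2) (Λ ^ (-(1 / 2 : ℝ))) K₀ *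
            Real.exp (-Λ * (σ - 1)) := by
        refine add_le_add ?_ hmodel
        rw [norm_mul, hnorm_coef]
        exact mul_le_mul_of_nonneg_left htails (by positivity)
    _ = _ := by rw [hxα]; ring

omit h18 h19 in
/-- **The frozen factor `q_C` on the box**: with `A = 1 + 1/Λ + i − s`, `B = A + 1` one has
`3/4 ≤ |A| ≤ 2`, `1/2 ≤ |B| ≤ 3`, hence `1/6 ≤ |q_C(s)| ≤ 4`. [cite: Montgomery1983, §4 (24)–(25)] -/
theorem cesaroQ_modelBox {Λ c₁ c₂ : ℝ} (hΛ : 20 ≤ Λ) (hc₁ : 12 ≤ c₁ * Real.log Λ)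
    (hc₂ : c₂ * Real.log Λ + 6 ≤ Λ / 2) {s : ℂ}
    (hs : s ∈ modelBox Λ (1 + c₁ * Real.log Λ / Λ) (1 + c₂ * Real.log Λ / Λ)) :
    (3 / 4 ≤ ‖zline Λ 1 - s‖ ∧ ‖zline Λ 1 - s‖ ≤ 2) ∧ (1 / 2 ≤ ‖zline Λ 1 - s + 1‖ ∧ ‖zline Λ 1 - s + 1‖ ≤ 3) ∧
      1 / 6 ≤ ‖cesaroQ Λ s‖ ∧ ‖cesaroQ Λ s‖ ≤ 4 := by
  have hΛ0 : 0 < Λ := by linarith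
  obtain ⟨hσ1, hσ2, ht, -, -, -⟩ := modelBox_basic hΛ hc₁ hc₂ hs
  have hΛinv : 1 / Λ ≤ 1 / 20 := one_div_le_one_div_of_le (by norm_num) hΛ
  have h5 : 5 / Λ ≤ 1 / 4 := by rw [div_le_iff₀ hΛ0]; linarith
  have hAre : (zline Λ 1 - s).re = 1 + 1 / Λ - s.re := by simp [zline]
  have hAim : (zline Λ 1 - s).im = 1 - s.im := by simp [zline]
  have hBre : (zline Λ 1 - s + 1).re = 2 + 1 / Λ - s.re := by simp [zline]; ring
  have hBim : (zline Λ 1 - s + 1).im = 1 - s.im := by simp [zline]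
  have him_lo : 3 / 4 ≤ |1 - s.im| := by
    have := abs_le.1 (ht.trans h5); rw [abs_of_pos (by linarith)]; linarith
  have him_hi : |1 - s.im| ≤ 5 / 4 := by
    have := abs_le.1 (ht.trans h5); rw [abs_of_pos (by linarith)]; linarith
  have hA : 3 / 4 ≤ ‖zline Λ 1 - s‖ ∧ ‖zline Λ 1 - s‖ ≤ 2 := by
    constructor
    · calc (3 : ℝ) / 4 ≤ |(zline Λ 1 - s).im| := by rw [hAim]; exact him_lo
        _ ≤ _ := abs_im_le_norm _
    · calc ‖zline Λ 1 - s‖ ≤ |(zline Λ 1 - s).re| + |(zline Λ 1 - s).im| := norm_le_abs_re_add_abs_im _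
        _ ≤ 1 / 2 + 5 / 4 := by
            rw [hAre, hAim]
            have h1 := one_div_pos.2 hΛ0
            have h2 : 0 < 11 / Λ := div_pos (by norm_num) hΛ0
            refine add_le_add (abs_le.2 ⟨by linarith, by linarith⟩) him_hi
        _ ≤ 2 := by norm_num
  have hB : 1 / 2 ≤ ‖zline Λ 1 - s + 1‖ ∧ ‖zline Λ 1 - s + 1‖ ≤ 3 := by
    constructor
    · calc (1 : ℝ) / 2 ≤ |(zline Λ 1 - s + 1).re| := by
            rw [hBre, abs_of_pos (by linarith [one_div_pos.2 hΛ0])]; linarith [one_div_pos.2 hΛ0]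
        _ ≤ _ := abs_re_le_norm _
    · calc ‖zline Λ 1 - s + 1‖ ≤ |(zline Λ 1 - s + 1).re| + |(zline Λ 1 - s + 1).im| :=
            norm_le_abs_re_add_abs_im _
        _ ≤ (1 + 1 / 20) + 5 / 4 := by
            rw [hBre, hBim]
            refine add_le_add (abs_le.2 ⟨by linarith [one_div_pos.2 hΛ0], by linarith [div_pos (show (0:ℝ) < 11 by norm_num) hΛ0]⟩) him_hi
        _ ≤ 3 := by norm_num
  refine ⟨hA, hB, ?_, ?_⟩
  · rw [cesaroQ, norm_div, norm_one, norm_mul]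
    rw [le_div_iff₀ (by nlinarith [hA.1, hB.1])]
    nlinarith [hA.2, hB.2, hA.1, hB.1]
  · rw [cesaroQ, norm_div, norm_one, norm_mul, div_le_iff₀ (by nlinarith [hA.1, hB.1])]
    nlinarith [hA.1, hB.1]

omit h18 h19 in
/-- **`q_C` is Lipschitz on the box** with constant `36`. [folklore] -/
theorem norm_cesaroQ_sub_le {Λ c₁ c₂ : ℝ} (hΛ : 20 ≤ Λ) (hc₁ : 12 ≤ c₁ * Real.log Λ)
    (hc₂ : c₂ * Real.log Λ + 6 ≤ Λ / 2) {s s' : ℂ}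
    (hs : s ∈ modelBox Λ (1 + c₁ * Real.log Λ / Λ) (1 + c₂ * Real.log Λ / Λ))
    (hs' : s' ∈ modelBox Λ (1 + c₁ * Real.log Λ / Λ) (1 + c₂ * Real.log Λ / Λ)) :
    ‖cesaroQ Λ s - cesaroQ Λ s'‖ ≤ 36 * ‖s - s'‖ := by
  obtain ⟨⟨hA1, hA2⟩, ⟨hB1, hB2⟩, -, -⟩ := cesaroQ_modelBox hΛ hc₁ hc₂ hs
  obtain ⟨⟨hA1', hA2'⟩, ⟨hB1', hB2'⟩, -, -⟩ := cesaroQ_modelBox hΛ hc₁ hc₂ hs'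
  set A := zline Λ 1 - s with hAdef
  set A' := zline Λ 1 - s' with hA'def
  have hA0 : A ≠ 0 := norm_pos_iff.1 (by linarith)
  have hA0' : A' ≠ 0 := norm_pos_iff.1 (by linarith)
  have hB0 : A + 1 ≠ 0 := norm_pos_iff.1 (by linarith)
  have hB0' : A' + 1 ≠ 0 := norm_pos_iff.1 (by linarith)
  have hdiff : cesaroQ Λ s - cesaroQ Λ s' = (s - s') * (A' + (A + 1)) / ((A + 1) * A * ((A' + 1) * A')) := by
    simp only [cesaroQ, ← hAdef, ← hA'def]
    have hAA : A' = A - (s' - s) := by rw [hAdef, hA'def]; ring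
    field_simp
    rw [hAA]; ring
  rw [hdiff, norm_div, norm_mul, norm_mul, norm_mul, norm_mul]
  rw [div_le_iff₀ (by positivity)]
  have h5 : ‖A' + (A + 1)‖ ≤ 5 := (norm_add_le _ _).trans (by linarith)
  have hden : (9 : ℝ) / 64 ≤ ‖A + 1‖ * ‖A‖ * (‖A' + 1‖ * ‖A'‖) := by
    have h1 : (3 : ℝ) / 8 ≤ ‖A + 1‖ * ‖A‖ := by nlinarith
    have h2 : (3 : ℝ) / 8 ≤ ‖A' + 1‖ * ‖A'‖ := by nlinarith
    nlinarith
  calc ‖s - s'‖ * ‖A' + (A + 1)‖ ≤ ‖s - s'‖ * 5 := mul_le_mul_of_nonneg_left h5 (norm_nonneg _)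
    _ = ‖s - s'‖ * (320 / 9) * (9 / 64) := by ring
    _ ≤ ‖s - s'‖ * (320 / 9) * (‖A + 1‖ * ‖A‖ * (‖A' + 1‖ * ‖A'‖)) :=
        mul_le_mul_of_nonneg_left hden (by positivity)
    _ ≤ 36 * ‖s - s'‖ * (‖A + 1‖ * ‖A‖ * (‖A' + 1‖ * ‖A'‖)) := by
        refine mul_le_mul_of_nonneg_right ?_ (by positivity)
        nlinarith [norm_nonneg (s - s')]

end ModelC

/-- **Twisted Cesàro zeros beyond `1 + c log log N/log N`** (hypothesis `hC` of
`montgomery1983_smoothedRemark_of_twisted_zeros`): for some `c > 0` and all large `N` there is a completely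
multiplicative `ψ`, unimodular at the primes — Montgomery's `a(n)` for a suitable `δ` — and a zero `s₀` of
`Σ_{n ≤ N} (1 − n/N) ψ(n) n^{−s}` with `Re s₀ > 1 + c log log N/log N` (the Theorem of the source for `C_N`,
"mutatis mutandis"). [cite: Montgomery1983, §1 p. 498 and §4] -/
theorem exists_cesaroTwisted_zeros :
    ∃ c : ℝ, 0 < c ∧ ∃ N₀ : ℕ, ∀ N : ℕ, N₀ < N → ∃ ψ : ℕ → ℂ,
      (∀ m n : ℕ, m ≠ 0 → n ≠ 0 → ψ (m * n) = ψ m * ψ n) ∧ (∀ p : ℕ, p.Prime → ‖ψ p‖ = 1) ∧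
      ∃ s₀ : ℂ, twistedPartialSum (fun n ↦ (1 - (n : ℂ) / N) * ψ n) N s₀ = 0 ∧
        1 + c * Real.log (Real.log N) / Real.log N < s₀.re := by
  -- the parameter `δ = δ_m` with `b̂(1) − b̂(0) − 1 > 0`, and the constants of Lemma 4
  obtain ⟨m, hm⟩ := exists_lt_montgomeryCoeff_one_sub_zero (c := 0) (by
    rw [lt_sub_iff_add_lt, zero_add, lt_div_iff₀ Real.pi_pos]; linarith [Real.pi_lt_four])
  obtain ⟨A₁, A₂, -, hA₂, h18⟩ := exists_norm_phi_add_log_le m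
  obtain ⟨A₃, A₄, hA₃, hA₄, h19⟩ := exists_norm_phiDeriv_add_inv_le m
  obtain ⟨ε₁, hε₁, hev⟩ := eventually_good m (A₁ := A₁) hA₂ hA₃ hA₄ hm (H := 4) (q₀ := 1 / 6) (q₁ := 4)
    (Lq := 36) (ρ₁ := 1) (ρ₂ := 1) (ρ₃ := 0) (by norm_num) (by norm_num) (by norm_num) one_pos one_pos le_rfl
  set cs := montgomeryCoeff m 1 - montgomeryCoeff m 0 - 1 with hcs
  -- transfer to `N → ∞` along `Λ = log N`
  have hlogN : Tendsto (fun N : ℕ ↦ Real.log (N : ℝ)) atTop atTop :=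
    Real.tendsto_log_atTop.comp tendsto_natCast_atTop_atTop
  obtain ⟨N₀, hN₀⟩ := eventually_atTop.1 (hlogN.eventually hev)
  refine ⟨cs / 4, by rw [hcs]; linarith, N₀, fun N hN ↦ ⟨fun n ↦ montgomeryTwist m n,
    fun a b _ _ ↦ montgomeryTwist_mul m a b, fun p hp ↦ norm_montgomeryTwist_prime m hp, ?_⟩⟩
  obtain ⟨g1, g2, g3, g4, g5, g6, g7, g8⟩ := hN₀ N hN.le
  set Λ := Real.log (N : ℝ) with hΛ
  have hΛ0 : 0 < Λ := by linarith
  have hc₁' : 12 ≤ cs / 2 * Real.log Λ := g3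
  have hc₂' : (cs + 1) * Real.log Λ + 6 ≤ Λ / 2 := by linarith
  -- the model hypothesis, with the tails absorbed into `44 Λ^{-2}`
  have hK₀1 : 1 ≤ ⌈Λ ^ 3⌉₊ := Nat.one_le_ceil_iff.2 (by positivity)
  have htail : 2 * (Λ + 1) / (⌈Λ ^ 3⌉₊ : ℕ) ≤ 44 * Λ ^ (-2 : ℝ) := by
    have hK : Λ ^ 3 ≤ ((⌈Λ ^ 3⌉₊ : ℕ) : ℝ) := Nat.le_ceil _
    have hKpos : (0 : ℝ) < ((⌈Λ ^ 3⌉₊ : ℕ) : ℝ) := by exact_mod_cast hK₀1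
    rw [div_le_iff₀ hKpos]
    have h2 : Λ ^ (-2 : ℝ) * Λ ^ 3 = Λ := by
      rw [show (Λ ^ 3 : ℝ) = Λ ^ (3 : ℝ) by norm_cast, ← Real.rpow_add hΛ0]; norm_num
    calc 2 * (Λ + 1) ≤ 44 * Λ := by linarith
      _ = 44 * Λ ^ (-2 : ℝ) * Λ ^ 3 := by rw [mul_assoc, h2]
      _ ≤ 44 * Λ ^ (-2 : ℝ) * ((⌈Λ ^ 3⌉₊ : ℕ) : ℝ) := mul_le_mul_of_nonneg_left hK (by positivity)
  have hmodel : ∀ s ∈ modelBox Λ (1 + cs / 2 * Real.log Λ / Λ) (1 + (cs + 1) * Real.log Λ / Λ),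
      ‖cesaroTwisted m N s - (fun _ : ℂ ↦ (1 : ℂ)) s * montgomeryF m s -
        (exp ((Λ : ℂ) * I) * ((Λ ^ (montgomeryCoeff m 1 - 1) / Real.Gamma (montgomeryCoeff m 1) : ℝ) : ℂ) *
          gOne m Λ 0) * cesaroQ Λ s * exp (-(Λ : ℂ) * (s - 1))‖ ≤
      Real.exp 1 / (2 * Real.pi) *
        (lineErr m A₁ A₂ A₃ A₄ 4 Λ (|1 + 1 / Λ - s.re| / 2) (Λ ^ (-(1 / 2 : ℝ))) ⌈Λ ^ 3⌉₊ + 44 * Λ ^ (-2 : ℝ)) *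
        Real.exp (-Λ * (s.re - 1)) := by
    intro s hs
    obtain ⟨h1, h2, h3, -⟩ := modelBox_basic g1 hc₁' hc₂' hs
    have hM := norm_cesaroTwisted_sub_model_le m h18 h19 hA₂ hA₃ hA₄ g1 g2 h1 h2 h3 hK₀1
    rw [one_mul]
    refine hM.trans (mul_le_mul_of_nonneg_right (mul_le_mul_of_nonneg_left (add_le_add le_rfl htail)
      (by positivity)) (Real.exp_pos _).le)
  obtain ⟨s, hs0, hsre⟩ := exists_zero_of_good m h18 h19 hm hε₁.le (by norm_num) (by norm_num) (by norm_num)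
    one_pos le_rfl (differentiable_cesaroTwisted m N).differentiableOn (differentiableOn_const 1)
    (fun s _ ↦ ⟨by simp, by simp, by simp⟩) (fun s hs ↦ (cesaroQ_modelBox g1 hc₁' hc₂' hs).2.2)
    (fun s hs s' hs' ↦ norm_cesaroQ_sub_le g1 hc₁' hc₂' hs hs') hmodel g1 g3 g4 g5 g6 g7 g8
  refine ⟨s, hs0, lt_of_le_of_lt ?_ hsre⟩
  -- `1 + (c*/4) LL/Λ ≤ σ₁ − 1/(2Λ)`
  have h1 : 1 ≤ cs / 2 * Real.log Λ := by linarith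
  rw [show cs / 4 * Real.log Λ / Λ = (cs / 2 * Real.log Λ / 2) / Λ by ring,
    show 1 + cs / 2 * Real.log Λ / Λ - 1 / (2 * Λ) = 1 + (cs / 2 * Real.log Λ - 1 / 2) / Λ by field_simp; ring]
  have : (cs / 2 * Real.log Λ / 2) / Λ ≤ (cs / 2 * Real.log Λ - 1 / 2) / Λ :=
    div_le_div_of_nonneg_right (by linarith) hΛ0.le
  linarith

end Cesaro

end Literature.Barriers.RiemannHypothesis

end
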